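import Summits.KontsevichZagierPeriods.KontsevichZagierPeriods.Theorems.K2SymbolChainsJensenIsScissorsDilation
import Summits.KontsevichZagierPeriods.KontsevichZagierPeriods.Theorems.K2SymbolChainsJensenIsScissorsMeasure

/-!
# Jensen is scissors — the band between two levels: existence and the signed Chasles relation

Support file for item stmt-KontsevichZagierPeriods-5204 (`JensenIsScissors`, route
KontsevichZagierPeriods/K2SymbolChains). For `0 < a ≤ b` `ℚ`-semialgebraic on a base `T` and a
`ℚ`-semialgebraic weight `G` with `G log a`, `G log b` integrable, the band representation
`[{(t, u) | t ∈ T, a t < u < b t}, G(t)/u]` exists (Tonelli; the fibre integral of `|G|/u` over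
`[a, b]` is exactly `|G| log (b/a)`), and with `L(W)` the signed unfolding of `G log W`
(`KZ.logUnfoldDomain` / `KZ.logUnfoldIntegrand`) the **signed Chasles relation**
`[L(b)] − [L(a)] − [band(a, b)] ∈ S` holds in any subgroup `S` containing the three scissors move
sets: over `{1 ≤ a}` cut `(1, b)` at `u = a`; over `{a < 1 ≤ b}` cut the band at `u = 1` and cancel
its lower part against the negative sheet of `L(a)`; over `{b < 1}` cut `(a, 1)` at `u = b` and
cancel. Only rule 1a) and the cancellation `[σ, f] + [σ, −f]` are used.
[Kontsevich–Zagier 2001, §1.2, rule 1)] [folklore]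
-/

noncomputable section

open MeasureTheory Set
open Literature.NumberTheory.Transcendental Literature.ModelTheory.ExponentialFields

namespace Summit.KontsevichZagierPeriods.K2SymbolChains.JensenIsScissorsProof

open Literature.NumberTheory.Transcendental.KZ

variable {m : ℕ} {S : AddSubgroup FormalRep}

/-! ### Existence of the band representation -/

/-- The band integrand `G(t)/u` is `ℚ`-semialgebraic on the open band (`a > 0`).
[BCR 1998, Prop. 2.2.6] [folklore] -/
theorem isSemialgebraicFunOn_band_integrand {T : Set (Fin m → ℝ)} {G a b : (Fin m → ℝ) → ℝ}
    (hG : IsSemialgebraicFunOn ℚ T G) (ha : IsSemialgebraicFunOn ℚ T a)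
    (hb : IsSemialgebraicFunOn ℚ T b) (ha0 : ∀ t ∈ T, 0 < a t) :
    IsSemialgebraicFunOn ℚ {z : Fin (m + 1) → ℝ | Fin.init z ∈ T ∧ a (Fin.init z) < z (Fin.last m) ∧
        z (Fin.last m) < b (Fin.init z)} (fun z => G (Fin.init z) / z (Fin.last m)) := by
  have hD := isSemialgebraic_oband ha hb
  exact IsSemialgebraicFunOn.div (hG.comp_init.mono (fun z hz => hz.1) hD)
    (isSemialgebraicFunOn_apply hD (Fin.last m)) fun z hz => ((ha0 _ hz.1).trans hz.2.1).ne'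

/-- **The band representation exists**: for `0 < a ≤ b` and `G log a`, `G log b` integrable on `T`
(all data `ℚ`-semialgebraic), `G(t)/u` is absolutely integrable on `{t ∈ T, a t < u < b t}` — by
Tonelli, the fibre integral being `|G(t)| log (b t / a t)`. [Kontsevich–Zagier 2001, §1.1] [folklore] -/
theorem exists_bandRep {T : Set (Fin m → ℝ)} {G a b : (Fin m → ℝ) → ℝ} (hT : IsSemialgebraic ℚ T)
    (hG : IsSemialgebraicFunOn ℚ T G) (ha : IsSemialgebraicFunOn ℚ T a)
    (hb : IsSemialgebraicFunOn ℚ T b) (ha0 : ∀ t ∈ T, 0 < a t) (hab : ∀ t ∈ T, a t ≤ b t)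
    (hGa : IntegrableOn (fun t => G t * Real.log (a t)) T)
    (hGb : IntegrableOn (fun t => G t * Real.log (b t)) T) :
    ∃ Rb : IntegralRep (m + 1), Rb.domain = {z : Fin (m + 1) → ℝ | Fin.init z ∈ T ∧
        a (Fin.init z) < z (Fin.last m) ∧ z (Fin.last m) < b (Fin.init z)} ∧
      Rb.integrand = fun z => G (Fin.init z) / z (Fin.last m) := by
  have hTm : MeasurableSet T := IsSemialgebraic.measurableSet_holds hT
  have hBs : IsSemialgebraic ℚ (KZlog.band T a b) := KZlog.isSemialgebraic_band ha hb
  have hBm : MeasurableSet (KZlog.band T a b) := IsSemialgebraic.measurableSet_holds hBs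
  -- integrability on the closed band
  have hWs : IsSemialgebraicFunOn ℚ (KZlog.band T a b) (fun z => G (Fin.init z) / z (Fin.last m)) :=
    IsSemialgebraicFunOn.div (hG.comp_init.mono (fun z hz => hz.1) hBs)
      (isSemialgebraicFunOn_apply hBs (Fin.last m)) fun z hz => ((ha0 _ hz.1).trans_le hz.2.1).ne'
  have hint : IntegrableOn (fun z : Fin (m + 1) → ℝ => G (Fin.init z) / z (Fin.last m)) (KZlog.band T a b) := by
    refine KZlog.integrableOn_band_of_lintegral_fibre_le hTm hBm (fun x t => KZlog.snoc_mem_band)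
      (aestronglyMeasurable_of_isSemialgebraicFunOn hWs hBm)
      (K := fun t => G t * Real.log (b t / a t)) (fun t ht => ?_) ?_
    · have h := lintegral_enorm_div_Icc (G t) (ha0 t ht) (hab t ht)
      simp only [Fin.init_snoc, Fin.snoc_last]
      rw [h, ← ofReal_norm, norm_mul, Real.norm_eq_abs, Real.norm_eq_abs,
        abs_of_nonneg (Real.log_nonneg ((one_le_div (ha0 t ht)).2 (hab t ht)))]
    · refine (hGb.sub hGa).congr_fun (fun t ht => ?_) hTm
      rw [Pi.sub_apply, Real.log_div ((ha0 t ht).trans_le (hab t ht)).ne' (ha0 t ht).ne']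
      ring
  refine ⟨⟨_, _, isSemialgebraic_oband ha hb, isSemialgebraicFunOn_band_integrand hG ha hb ha0,
    hint.mono_set fun z hz => ⟨hz.1, hz.2.1.le, hz.2.2.le⟩⟩, rfl, rfl⟩

/-! ### The signed Chasles relation, piece by piece -/

/-- Chasles over `{1 ≤ a ≤ b}`: cut `(1, b)` at `u = a`. [Kontsevich–Zagier 2001, §1.2, rule 1)]
[folklore] -/
theorem chasles_of_one_le (hS : domainAddRel ∪ integrandAddRel ∪ changeOfVariablesRel ⊆ S)
    {T : Set (Fin m → ℝ)} {G a b : (Fin m → ℝ) → ℝ} (hT : IsSemialgebraic ℚ T)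
    (ha : IsSemialgebraicFunOn ℚ T a) (hb : IsSemialgebraicFunOn ℚ T b)
    (h1a : ∀ t ∈ T, 1 ≤ a t) (hab : ∀ t ∈ T, a t ≤ b t) (Rb Ra Rband : IntegralRep (m + 1))
    (hbd : Rb.domain = logUnfoldDomain T b) (hbi : EqOn Rb.integrand (logUnfoldIntegrand G) Rb.domain)
    (had : Ra.domain = logUnfoldDomain T a) (hai : EqOn Ra.integrand (logUnfoldIntegrand G) Ra.domain)
    (hBd : Rband.domain = {z : Fin (m + 1) → ℝ | Fin.init z ∈ T ∧ a (Fin.init z) < z (Fin.last m) ∧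
        z (Fin.last m) < b (Fin.init z)})
    (hBi : EqOn Rband.integrand (fun z => G (Fin.init z) / z (Fin.last m)) Rband.domain) :
    of Rb - of Ra - of Rband ∈ S := by
  have h1b : ∀ t ∈ T, 1 ≤ b t := fun t ht => (h1a t ht).trans (hab t ht)
  have hc1 : IsSemialgebraicFunOn ℚ T (fun _ => (1 : ℝ)) := by simpa using isSemialgebraicFunOn_ratCast hT 1
  set A : Set (Fin (m + 1) → ℝ) := {z | Fin.init z ∈ T ∧ (fun _ => (1 : ℝ)) (Fin.init z) < z (Fin.last m) ∧
    z (Fin.last m) < a (Fin.init z)} with hA_def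
  set Bn : Set (Fin (m + 1) → ℝ) := {z | Fin.init z ∈ T ∧ a (Fin.init z) < z (Fin.last m) ∧
    z (Fin.last m) < b (Fin.init z)} with hBn_def
  have hAs : IsSemialgebraic ℚ A := isSemialgebraic_oband hc1 ha
  have hBns : IsSemialgebraic ℚ Bn := isSemialgebraic_oband ha hb
  have hAr : A ⊆ Rb.domain := by
    rintro z ⟨ht, h1, h2⟩; rw [hbd]; exact ⟨ht, Or.inl ⟨h1, h2.trans_le (hab _ ht)⟩⟩
  have hBr : Bn ⊆ Rb.domain := by
    rintro z ⟨ht, h1, h2⟩; rw [hbd]; exact ⟨ht, Or.inl ⟨(h1a _ ht).trans_lt h1, h2⟩⟩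
  have e1 : of Rb - of (Rb.restrict A hAs hAr) - of (Rb.restrict Bn hBns hBr) ∈ S := by
    refine of_sub_restrict_sub_restrict_mem_of_null hS Rb hAs hBns hAr hBr ?_ ?_
    · rw [show A ∩ Bn = ∅ by
        ext z
        simp only [hA_def, hBn_def, mem_inter_iff, mem_setOf_eq, mem_empty_iff_false, iff_false]
        rintro ⟨⟨-, -, h1⟩, -, h2, -⟩; exact lt_asymm h1 h2]
      exact measure_empty
    · refine measure_mono_null (fun z hz => ?_) (volume_graph_eq_zero ha)
      rw [hbd] at hz
      rcases hz with ⟨⟨ht, h | h⟩, hn⟩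
      · simp only [hA_def, hBn_def, mem_union, mem_setOf_eq, not_or, not_and, not_lt] at hn
        refine ⟨ht, le_antisymm ?_ (hn.1 ht h.1)⟩
        by_contra hlt
        exact (not_lt.2 (hn.2 ht (not_le.1 hlt))) h.2
      · exact absurd (h.1.trans h.2) (not_lt.2 (h1b _ ht))
  have e2 : of (Rb.restrict A hAs hAr) - of Ra ∈ S := by
    refine of_sub_of_mem_of_eqOn hS ?_ (fun z hz => ?_)
    · rw [had, IntegralRep.domain_restrict, hA_def, logUnfoldDomain_eq_of_one_le h1a]
    · rw [IntegralRep.integrand_restrict, hbi (hAr hz), hai]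
      rw [had, logUnfoldDomain_eq_of_one_le h1a]; exact hz
  have e3 : of (Rb.restrict Bn hBns hBr) - of Rband ∈ S := by
    refine of_sub_of_mem_of_eqOn hS (by rw [hBd, IntegralRep.domain_restrict]) (fun z hz => ?_)
    have hz' : z ∈ Bn := hz
    rw [IntegralRep.integrand_restrict, hbi (hBr hz), hBi (by rw [hBd]; exact hz'), logUnfoldIntegrand,
      if_pos ((h1a _ hz'.1).trans_lt hz'.2.1), one_mul]
  have : of Rb - of Ra - of Rband = (of Rb - of (Rb.restrict A hAs hAr) - of (Rb.restrict Bn hBns hBr)) +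
      (of (Rb.restrict A hAs hAr) - of Ra) + (of (Rb.restrict Bn hBns hBr) - of Rband) := by abel
  rw [this]
  exact S.add_mem (S.add_mem e1 e2) e3

/-- Chasles over `{a < 1 ≤ b}`: cut the band at `u = 1` and cancel its lower part against the
negative sheet of `L(a)`. [Kontsevich–Zagier 2001, §1.2, rule 1)] [folklore] -/
theorem chasles_of_lt_one_le (hS : domainAddRel ∪ integrandAddRel ∪ changeOfVariablesRel ⊆ S)
    {T : Set (Fin m → ℝ)} {G a b : (Fin m → ℝ) → ℝ} (hT : IsSemialgebraic ℚ T)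
    (ha : IsSemialgebraicFunOn ℚ T a) (hb : IsSemialgebraicFunOn ℚ T b)
    (ha1 : ∀ t ∈ T, a t < 1) (h1b : ∀ t ∈ T, 1 ≤ b t) (Rb Ra Rband : IntegralRep (m + 1))
    (hbd : Rb.domain = logUnfoldDomain T b) (hbi : EqOn Rb.integrand (logUnfoldIntegrand G) Rb.domain)
    (had : Ra.domain = logUnfoldDomain T a) (hai : EqOn Ra.integrand (logUnfoldIntegrand G) Ra.domain)
    (hBd : Rband.domain = {z : Fin (m + 1) → ℝ | Fin.init z ∈ T ∧ a (Fin.init z) < z (Fin.last m) ∧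
        z (Fin.last m) < b (Fin.init z)})
    (hBi : EqOn Rband.integrand (fun z => G (Fin.init z) / z (Fin.last m)) Rband.domain) :
    of Rb - of Ra - of Rband ∈ S := by
  have hc1 : IsSemialgebraicFunOn ℚ T (fun _ => (1 : ℝ)) := by simpa using isSemialgebraicFunOn_ratCast hT 1
  set A : Set (Fin (m + 1) → ℝ) := {z | Fin.init z ∈ T ∧ a (Fin.init z) < z (Fin.last m) ∧
    z (Fin.last m) < (fun _ => (1 : ℝ)) (Fin.init z)} with hA_def
  set Bn : Set (Fin (m + 1) → ℝ) := {z | Fin.init z ∈ T ∧ (fun _ => (1 : ℝ)) (Fin.init z) < z (Fin.last m) ∧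
    z (Fin.last m) < b (Fin.init z)} with hBn_def
  have hAs : IsSemialgebraic ℚ A := isSemialgebraic_oband ha hc1
  have hBns : IsSemialgebraic ℚ Bn := isSemialgebraic_oband hc1 hb
  have hAr : A ⊆ Rband.domain := by
    rintro z ⟨ht, h1, h2⟩; rw [hBd]; exact ⟨ht, h1, h2.trans_le (h1b _ ht)⟩
  have hBr : Bn ⊆ Rband.domain := by
    rintro z ⟨ht, h1, h2⟩; rw [hBd]; exact ⟨ht, (ha1 _ ht).trans h1, h2⟩
  have e1 : of Rband - of (Rband.restrict A hAs hAr) - of (Rband.restrict Bn hBns hBr) ∈ S := by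
    refine of_sub_restrict_sub_restrict_mem_of_null hS Rband hAs hBns hAr hBr ?_ ?_
    · rw [show A ∩ Bn = ∅ by
        ext z
        simp only [hA_def, hBn_def, mem_inter_iff, mem_setOf_eq, mem_empty_iff_false, iff_false]
        rintro ⟨⟨-, -, h1⟩, -, h2, -⟩; exact lt_asymm h1 h2]
      exact measure_empty
    · refine measure_mono_null (fun z hz => ?_) (volume_setOf_last_eq_zero (n := m) 1)
      rw [hBd] at hz
      rcases hz with ⟨⟨ht, h1, h2⟩, hn⟩
      simp only [hA_def, hBn_def, mem_union, mem_setOf_eq, not_or, not_and, not_lt] at hn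
      have hge : 1 ≤ z (Fin.last m) := hn.1 ht h1
      have hle : z (Fin.last m) ≤ 1 := by
        by_contra hlt
        exact (not_lt.2 (hn.2 ht (not_le.1 hlt))) h2
      exact le_antisymm hle hge
  have e2 : of (Rband.restrict Bn hBns hBr) - of Rb ∈ S := by
    refine of_sub_of_mem_of_eqOn hS ?_ (fun z hz => ?_)
    · rw [hbd, IntegralRep.domain_restrict, hBn_def, logUnfoldDomain_eq_of_one_le h1b]
    · have hz' : z ∈ Bn := hz
      have hzb : z ∈ Rb.domain := by rw [hbd, logUnfoldDomain_eq_of_one_le h1b]; exact hz'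
      rw [IntegralRep.integrand_restrict, hBi (hBr hz), hbi hzb, logUnfoldIntegrand, if_pos hz'.2.1, one_mul]
  have e3 : of Ra + of (Rband.restrict A hAs hAr) ∈ S := by
    refine of_add_of_mem_of_eqOn_neg hS ?_ (fun z hz => ?_)
    · rw [had, IntegralRep.domain_restrict, hA_def, logUnfoldDomain_eq_of_le_one (fun t ht => (ha1 t ht).le)]
    · have hz' : z ∈ A := by rw [had, logUnfoldDomain_eq_of_le_one (fun t ht => (ha1 t ht).le)] at hz; exact hz
      rw [IntegralRep.integrand_restrict, Pi.neg_apply, hBi (hAr hz'), hai hz, logUnfoldIntegrand,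
        if_neg (not_lt.2 hz'.2.2.le)]
      ring
  have : of Rb - of Ra - of Rband = -(of Rband - of (Rband.restrict A hAs hAr) - of (Rband.restrict Bn hBns hBr)) -
      (of (Rband.restrict Bn hBns hBr) - of Rb) - (of Ra + of (Rband.restrict A hAs hAr)) := by abel
  rw [this]
  exact S.sub_mem (S.sub_mem (S.neg_mem e1) e2) e3

/-- Chasles over `{b < 1}` (`a ≤ b`): cut `(a, 1)` at `u = b` and cancel its lower part against the
band. [Kontsevich–Zagier 2001, §1.2, rule 1)] [folklore] -/
theorem chasles_of_lt_one (hS : domainAddRel ∪ integrandAddRel ∪ changeOfVariablesRel ⊆ S)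
    {T : Set (Fin m → ℝ)} {G a b : (Fin m → ℝ) → ℝ}
    (ha : IsSemialgebraicFunOn ℚ T a) (hb : IsSemialgebraicFunOn ℚ T b) (hT : IsSemialgebraic ℚ T)
    (hab : ∀ t ∈ T, a t ≤ b t) (hb1 : ∀ t ∈ T, b t < 1) (Rb Ra Rband : IntegralRep (m + 1))
    (hbd : Rb.domain = logUnfoldDomain T b) (hbi : EqOn Rb.integrand (logUnfoldIntegrand G) Rb.domain)
    (had : Ra.domain = logUnfoldDomain T a) (hai : EqOn Ra.integrand (logUnfoldIntegrand G) Ra.domain)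
    (hBd : Rband.domain = {z : Fin (m + 1) → ℝ | Fin.init z ∈ T ∧ a (Fin.init z) < z (Fin.last m) ∧
        z (Fin.last m) < b (Fin.init z)})
    (hBi : EqOn Rband.integrand (fun z => G (Fin.init z) / z (Fin.last m)) Rband.domain) :
    of Rb - of Ra - of Rband ∈ S := by
  have ha1 : ∀ t ∈ T, a t ≤ 1 := fun t ht => ((hab t ht).trans_lt (hb1 t ht)).le
  have hc1 : IsSemialgebraicFunOn ℚ T (fun _ => (1 : ℝ)) := by simpa using isSemialgebraicFunOn_ratCast hT 1
  set A : Set (Fin (m + 1) → ℝ) := {z | Fin.init z ∈ T ∧ a (Fin.init z) < z (Fin.last m) ∧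
    z (Fin.last m) < b (Fin.init z)} with hA_def
  set Bn : Set (Fin (m + 1) → ℝ) := {z | Fin.init z ∈ T ∧ b (Fin.init z) < z (Fin.last m) ∧
    z (Fin.last m) < (fun _ => (1 : ℝ)) (Fin.init z)} with hBn_def
  have hAs : IsSemialgebraic ℚ A := isSemialgebraic_oband ha hb
  have hBns : IsSemialgebraic ℚ Bn := isSemialgebraic_oband hb hc1
  have hAr : A ⊆ Ra.domain := by
    rintro z ⟨ht, h1, h2⟩; rw [had]; exact ⟨ht, Or.inr ⟨h1, h2.trans (hb1 _ ht)⟩⟩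
  have hBr : Bn ⊆ Ra.domain := by
    rintro z ⟨ht, h1, h2⟩; rw [had]; exact ⟨ht, Or.inr ⟨(hab _ ht).trans_lt h1, h2⟩⟩
  have e1 : of Ra - of (Ra.restrict A hAs hAr) - of (Ra.restrict Bn hBns hBr) ∈ S := by
    refine of_sub_restrict_sub_restrict_mem_of_null hS Ra hAs hBns hAr hBr ?_ ?_
    · rw [show A ∩ Bn = ∅ by
        ext z
        simp only [hA_def, hBn_def, mem_inter_iff, mem_setOf_eq, mem_empty_iff_false, iff_false]
        rintro ⟨⟨-, -, h1⟩, -, h2, -⟩; exact lt_asymm h1 h2]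
      exact measure_empty
    · refine measure_mono_null (fun z hz => ?_) (volume_graph_eq_zero hb)
      rw [had] at hz
      rcases hz with ⟨⟨ht, h | h⟩, hn⟩
      · exact absurd (h.1.trans h.2) (not_lt.2 (ha1 _ ht))
      · simp only [hA_def, hBn_def, mem_union, mem_setOf_eq, not_or, not_and, not_lt] at hn
        refine ⟨ht, le_antisymm ?_ (hn.1 ht h.1)⟩
        by_contra hlt
        exact (not_lt.2 (hn.2 ht (not_le.1 hlt))) h.2
  have e2 : of (Ra.restrict Bn hBns hBr) - of Rb ∈ S := by
    refine of_sub_of_mem_of_eqOn hS ?_ (fun z hz => ?_)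
    · rw [hbd, IntegralRep.domain_restrict, hBn_def, logUnfoldDomain_eq_of_le_one (fun t ht => (hb1 t ht).le)]
    · have hz' : z ∈ Bn := hz
      have hzb : z ∈ Rb.domain := by
        rw [hbd, logUnfoldDomain_eq_of_le_one (fun t ht => (hb1 t ht).le)]; exact hz'
      rw [IntegralRep.integrand_restrict, hai (hBr hz), hbi hzb]
  have e3 : of Rband + of (Ra.restrict A hAs hAr) ∈ S := by
    refine of_add_of_mem_of_eqOn_neg hS (by rw [hBd, IntegralRep.domain_restrict]) (fun z hz => ?_)
    have hz' : z ∈ A := by rw [hBd] at hz; exact hz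
    rw [IntegralRep.integrand_restrict, Pi.neg_apply, hai (hAr hz'), hBi hz, logUnfoldIntegrand,
      if_neg (not_lt.2 ((hz'.2.2.trans (hb1 _ hz'.1)).le))]
    ring
  have : of Rb - of Ra - of Rband = -(of Ra - of (Ra.restrict A hAs hAr) - of (Ra.restrict Bn hBns hBr)) -
      (of (Ra.restrict Bn hBns hBr) - of Rb) - (of Rband + of (Ra.restrict A hAs hAr)) := by abel
  rw [this]
  exact S.sub_mem (S.sub_mem (S.neg_mem e1) e2) e3

/-! ### The signed Chasles relation over a general base -/

/-- Restricting the base of an open band. [folklore] -/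
theorem oband_inter_cyl (T P : Set (Fin m → ℝ)) (a b : (Fin m → ℝ) → ℝ) :
    {z : Fin (m + 1) → ℝ | Fin.init z ∈ T ∧ a (Fin.init z) < z (Fin.last m) ∧ z (Fin.last m) < b (Fin.init z)} ∩
        {z | Fin.init z ∈ P} =
      {z : Fin (m + 1) → ℝ | Fin.init z ∈ T ∩ P ∧ a (Fin.init z) < z (Fin.last m) ∧
        z (Fin.last m) < b (Fin.init z)} := by
  ext z; simp only [mem_inter_iff, mem_setOf_eq]; tauto

/-- Removing part of the base of an open band. [folklore] -/
theorem oband_diff_cyl (T P : Set (Fin m → ℝ)) (a b : (Fin m → ℝ) → ℝ) :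
    {z : Fin (m + 1) → ℝ | Fin.init z ∈ T ∧ a (Fin.init z) < z (Fin.last m) ∧ z (Fin.last m) < b (Fin.init z)} \
        {z | Fin.init z ∈ P} =
      {z : Fin (m + 1) → ℝ | Fin.init z ∈ T \ P ∧ a (Fin.init z) < z (Fin.last m) ∧
        z (Fin.last m) < b (Fin.init z)} := by
  ext z; simp only [mem_sdiff, mem_setOf_eq]; tauto

/-- **The signed Chasles relation** `[L(b)] − [L(a)] − [band(a, b)] ∈ S` for `a ≤ b`
`ℚ`-semialgebraic on `T` (split the base into `{1 ≤ a}`, `{a < 1 ≤ b}`, `{b < 1}`, rule 1a), and use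
the three pieces). [Kontsevich–Zagier 2001, §1.2, rule 1)] [folklore] -/
theorem of_logUnfold_sub_sub_band_mem (hS : domainAddRel ∪ integrandAddRel ∪ changeOfVariablesRel ⊆ S)
    {T : Set (Fin m → ℝ)} {G a b : (Fin m → ℝ) → ℝ} (hT : IsSemialgebraic ℚ T)
    (ha : IsSemialgebraicFunOn ℚ T a) (hb : IsSemialgebraicFunOn ℚ T b)
    (hab : ∀ t ∈ T, a t ≤ b t) (Rb Ra Rband : IntegralRep (m + 1))
    (hbd : Rb.domain = logUnfoldDomain T b) (hbi : EqOn Rb.integrand (logUnfoldIntegrand G) Rb.domain)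
    (had : Ra.domain = logUnfoldDomain T a) (hai : EqOn Ra.integrand (logUnfoldIntegrand G) Ra.domain)
    (hBd : Rband.domain = {z : Fin (m + 1) → ℝ | Fin.init z ∈ T ∧ a (Fin.init z) < z (Fin.last m) ∧
        z (Fin.last m) < b (Fin.init z)})
    (hBi : EqOn Rband.integrand (fun z => G (Fin.init z) / z (Fin.last m)) Rband.domain) :
    of Rb - of Ra - of Rband ∈ S := by
  -- the pieces of the base
  have ha1s : IsSemialgebraicFunOn ℚ T (fun t => a t - 1) :=
    (IsSemialgebraicFunOn.sub_holds ha (isSemialgebraicFunOn_ratCast hT 1)).congr fun t _ => by simp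
  have hb1s : IsSemialgebraicFunOn ℚ T (fun t => b t - 1) :=
    (IsSemialgebraicFunOn.sub_holds hb (isSemialgebraicFunOn_ratCast hT 1)).congr fun t _ => by simp
  set P : Set (Fin m → ℝ) := {t | t ∈ T ∧ 0 ≤ a t - 1} with hP_def
  set Q : Set (Fin m → ℝ) := {t | t ∈ T ∧ 0 ≤ b t - 1} with hQ_def
  have hP : IsSemialgebraic ℚ P := ha1s.isSemialgebraic_sep_nonneg
  have hQ : IsSemialgebraic ℚ Q := hb1s.isSemialgebraic_sep_nonneg
  have hT₁ : IsSemialgebraic ℚ (T ∩ P) := hT.inter hP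
  have hT' : IsSemialgebraic ℚ (T \ P) := hT.diff hP
  have hT₂ : IsSemialgebraic ℚ ((T \ P) ∩ Q) := hT'.inter hQ
  have hT₃ : IsSemialgebraic ℚ ((T \ P) \ Q) := hT'.diff hQ
  have h1a : ∀ t ∈ T ∩ P, 1 ≤ a t := fun t ht => by have := ht.2.2; linarith
  have ha1' : ∀ t ∈ T \ P, a t < 1 := fun t ht => by
    by_contra h; exact ht.2 ⟨ht.1, by linarith [not_lt.1 h]⟩
  have h1b₂ : ∀ t ∈ (T \ P) ∩ Q, 1 ≤ b t := fun t ht => by have := ht.2.2; linarith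
  have hb1₃ : ∀ t ∈ (T \ P) \ Q, b t < 1 := fun t ht => by
    by_contra h; exact ht.2 ⟨ht.1.1, by linarith [not_lt.1 h]⟩
  -- generic two-level splitting of a representation over `P` then `Q`
  have split : ∀ (X : IntegralRep (m + 1)),
      ∃ X₁ X₂ X₃ : IntegralRep (m + 1),
        X₁.domain = X.domain ∩ {z | Fin.init z ∈ P} ∧ X₁.integrand = X.integrand ∧
        X₂.domain = (X.domain \ {z | Fin.init z ∈ P}) ∩ {z | Fin.init z ∈ Q} ∧ X₂.integrand = X.integrand ∧
        X₃.domain = (X.domain \ {z | Fin.init z ∈ P}) \ {z | Fin.init z ∈ Q} ∧ X₃.integrand = X.integrand ∧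
        of X - of X₁ - of X₂ - of X₃ ∈ S := by
    intro X
    have s₁ := of_sub_restrict_base_mem hS X hP
    set X₁ := X.restrict (X.domain ∩ {z | Fin.init z ∈ P})
      (X.isSemialgebraic_domain.inter (isSemialgebraic_cyl hP)) inter_subset_left
    set X' := X.restrict (X.domain \ {z | Fin.init z ∈ P})
      (X.isSemialgebraic_domain.diff (isSemialgebraic_cyl hP)) sdiff_subset
    have s₂ := of_sub_restrict_base_mem hS X' hQ
    refine ⟨X₁, X'.restrict (X'.domain ∩ {z | Fin.init z ∈ Q})
      (X'.isSemialgebraic_domain.inter (isSemialgebraic_cyl hQ)) inter_subset_left,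
      X'.restrict (X'.domain \ {z | Fin.init z ∈ Q})
      (X'.isSemialgebraic_domain.diff (isSemialgebraic_cyl hQ)) sdiff_subset,
      rfl, rfl, rfl, rfl, rfl, rfl, ?_⟩
    have : of X - of X₁ - of (X'.restrict (X'.domain ∩ {z | Fin.init z ∈ Q})
        (X'.isSemialgebraic_domain.inter (isSemialgebraic_cyl hQ)) inter_subset_left) -
        of (X'.restrict (X'.domain \ {z | Fin.init z ∈ Q})
        (X'.isSemialgebraic_domain.diff (isSemialgebraic_cyl hQ)) sdiff_subset) =
        (of X - of X₁ - of X') + (of X' - of (X'.restrict (X'.domain ∩ {z | Fin.init z ∈ Q})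
        (X'.isSemialgebraic_domain.inter (isSemialgebraic_cyl hQ)) inter_subset_left) -
        of (X'.restrict (X'.domain \ {z | Fin.init z ∈ Q})
        (X'.isSemialgebraic_domain.diff (isSemialgebraic_cyl hQ)) sdiff_subset)) := by abel
    rw [this]
    exact S.add_mem s₁ s₂
  obtain ⟨B₁, B₂, B₃, hB₁d, hB₁i, hB₂d, hB₂i, hB₃d, hB₃i, sB⟩ := split Rb
  obtain ⟨A₁, A₂, A₃, hA₁d, hA₁i, hA₂d, hA₂i, hA₃d, hA₃i, sA⟩ := split Ra
  obtain ⟨D₁, D₂, D₃, hD₁d, hD₁i, hD₂d, hD₂i, hD₃d, hD₃i, sD⟩ := split Rband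
  -- the three pieces
  have p₁ := chasles_of_one_le hS (G := G) hT₁ (ha.mono inter_subset_left hT₁) (hb.mono inter_subset_left hT₁)
    h1a (fun t ht => hab t ht.1) B₁ A₁ D₁
    (by rw [hB₁d, hbd, logUnfoldDomain_inter_cyl]) (by rw [hB₁i]; exact fun z hz => hbi (hB₁d ▸ hz).1)
    (by rw [hA₁d, had, logUnfoldDomain_inter_cyl]) (by rw [hA₁i]; exact fun z hz => hai (hA₁d ▸ hz).1)
    (by rw [hD₁d, hBd, oband_inter_cyl]) (by rw [hD₁i]; exact fun z hz => hBi (hD₁d ▸ hz).1)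
  have p₂ := chasles_of_lt_one_le hS (G := G) hT₂ (ha.mono (inter_subset_left.trans sdiff_subset) hT₂)
    (hb.mono (inter_subset_left.trans sdiff_subset) hT₂)
    (fun t ht => ha1' t ht.1) h1b₂ B₂ A₂ D₂
    (by rw [hB₂d, hbd, logUnfoldDomain_diff_cyl, logUnfoldDomain_inter_cyl])
    (by rw [hB₂i]; exact fun z hz => hbi (hB₂d ▸ hz).1.1)
    (by rw [hA₂d, had, logUnfoldDomain_diff_cyl, logUnfoldDomain_inter_cyl])
    (by rw [hA₂i]; exact fun z hz => hai (hA₂d ▸ hz).1.1)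
    (by rw [hD₂d, hBd, oband_diff_cyl, oband_inter_cyl])
    (by rw [hD₂i]; exact fun z hz => hBi (hD₂d ▸ hz).1.1)
  have p₃ := chasles_of_lt_one hS (G := G) (ha.mono (sdiff_subset.trans sdiff_subset) hT₃)
    (hb.mono (sdiff_subset.trans sdiff_subset) hT₃) hT₃ (fun t ht => hab t ht.1.1) hb1₃ B₃ A₃ D₃
    (by rw [hB₃d, hbd, logUnfoldDomain_diff_cyl, logUnfoldDomain_diff_cyl])
    (by rw [hB₃i]; exact fun z hz => hbi (hB₃d ▸ hz).1.1)
    (by rw [hA₃d, had, logUnfoldDomain_diff_cyl, logUnfoldDomain_diff_cyl])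
    (by rw [hA₃i]; exact fun z hz => hai (hA₃d ▸ hz).1.1)
    (by rw [hD₃d, hBd, oband_diff_cyl, oband_diff_cyl])
    (by rw [hD₃i]; exact fun z hz => hBi (hD₃d ▸ hz).1.1)
  have : of Rb - of Ra - of Rband = (of Rb - of B₁ - of B₂ - of B₃) - (of Ra - of A₁ - of A₂ - of A₃) -
      (of Rband - of D₁ - of D₂ - of D₃) + (of B₁ - of A₁ - of D₁) + (of B₂ - of A₂ - of D₂) +
      (of B₃ - of A₃ - of D₃) := by abel
  rw [this]
  exact S.add_mem (S.add_mem (S.add_mem (S.sub_mem (S.sub_mem sB sA) sD) p₁) p₂) p₃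

end Summit.KontsevichZagierPeriods.K2SymbolChains.JensenIsScissorsProof
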